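import Mathlib
import Literature.Computability.Complexity.ExtMonotoneCliqueGate
import Summits.PneNP.PneNP.Theorems.ConvexRankGatesConvexGateBlindXorDefs
import Summits.PneNP.PneNP.Theorems.ConvexRankGatesConvexGateBlindStubCliqueProjectsXorHelpers

/-!
# PneNP / ConvexRankGates — `ConvexGateBlind`, line `xor-door-perfect-completeness`: `3XOR-UNSAT` is a projection of `CLIQUE`

Stub file of the crux `ConvexGateBlind` (item `stmt-PneNP-10680`, `--supports`; closes nothing by
itself): it proves the registered stub `stub_cliqueProjectsXor : XorIsCliqueProjection` of the line
— `3XOR-UNSAT_n` on the 3-sparse pool (`Pool n`, `2n³` equations `y a + y b + y c = β` over `𝔽₂`)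
is a monotone AND-projection of `CLIQUE(M, k)` with `M, k ≤ (n + 2)^8` (the universality half of
the line; `stub_transport` then carries CONV-hardness from XOR down to CLIQUE).

The combinatorial core is the DERIVATION GADGET of `…StubCliqueProjectsXorHelpers.lean`
(namespace `XorDoor.CliqueXor`): `L = 2n³` steps enumerate the pool (`eqv`), a vertex
`(j, i, b, c) : Vtx` carries a step `j`, a coordinate `i : Option (Fin n)` (`none` = right-hand
side), the state bit before the step and the decision whether the step's equation is used; two
vertices are adjacent at the input `v` (`Good`) iff they sit at distinct positions `(j, i)`, are
valid (state `0` at the first step, target `(0, …, 0 ∣ 1)` after the last), consistent (same step ⇒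
same decision, consecutive steps hand the state over) and every USED equation is selected by `v`.
By `xorGadget_goodSet_iff`, `L (n + 1)` pairwise-adjacent vertices exist iff the selected system is
unsatisfiable (a clique is a Gaussian derivation of `0 = 1`; linear-algebra duality over `𝔽₂`).

Here (§1) the adjacency is realised by LITERALS on the edges of `K_M` (`M = #Vtx`, vertices
enumerated by `eV`): the pair `{p, q}` gets the constant `0` unless the vertex-only conditions hold,
and then the AND-mask of the used equations (`1`, `v_e` or `v_e ∧ v_{e'}`: `mask`, `litOf`, `rho`,
symmetric by ordering the two indices); `adj_iff` / `cliqueFn_rho_iff` identify the cliques of the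
substituted graph, and `projectsOnto_succ` is the projection for `n + 1` variables. (§2) The corner
`n = 0` (`3XOR-UNSAT_0 ≡ 0 = CLIQUE(0, 1)`), the size bookkeeping `M ≤ 8(n+1)³(n+2) ≤ (n+3)^8`,
`k = 2(n+1)³(n+2) ≤ (n+3)^8`, and the stub. Everything is [folklore] (cf. Göös–Kamath–Robere–Sokolov
2019 for the monotone function XOR-SAT and its CLIQUE-type universality arguments).
-/

set_option linter.dupNamespace false -- `Summit.PneNP.PneNP.…`: summit = sub-problem (D-0017)

namespace Summit.PneNP.PneNP.Theorems.XorDoor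

open Finset Literature.Computability.Complexity

noncomputable section

/-! ## §1 Literals on the edges of `K_M` -/

namespace CliqueXor

variable {n L : ℕ} (eqn : Fin L → Pool n)

/-- The AND-mask of a pair of vertices: the conjunction of the USED equations of the two steps
(`1`, `v_e`, or `v_e ∧ v_{e'}`). [folklore] -/
def mask (p q : Vtx n L) : Lit (Pool n) :=
  if p.c = true then (if q.c = true then Lit.and (eqn p.j) (eqn q.j) else Lit.var (eqn p.j))
  else (if q.c = true then Lit.var (eqn q.j) else Lit.const true)

/-- The mask evaluates to `true` iff every used equation of the pair is selected. [folklore] -/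
theorem mask_eval (v : Pool n → Bool) (p q : Vtx n L) :
    (mask eqn p q).eval v = true ↔
      (p.c = true → v (eqn p.j) = true) ∧ (q.c = true → v (eqn q.j) = true) := by
  unfold mask
  cases p.c <;> cases q.c <;> simp [Lit.eval]

open Classical in
/-- The literal substituted for the pair `{p, q}` of gadget vertices: the AND-mask if the two
vertices sit at distinct positions, are both valid and are consistent, and the constant `0`
otherwise. [folklore] -/
def litOf (p q : Vtx n L) : Lit (Pool n) :=
  if (p.j, p.i) ≠ (q.j, q.i) ∧ Valid eqn p ∧ Valid eqn q ∧ Compat eqn p q then mask eqn p q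
  else Lit.const false

/-- The literal of `{p, q}` is on at `v` iff `p, q` are adjacent in the gadget at `v`. [folklore] -/
theorem litOf_eval (v : Pool n → Bool) (p q : Vtx n L) :
    (litOf eqn p q).eval v = true ↔ Good eqn v p q := by
  unfold litOf Good
  split_ifs with h
  · rw [mask_eval]
    exact ⟨fun hm => ⟨h.1, h.2.1, h.2.2.1, h.2.2.2, hm.1, hm.2⟩,
      fun hg => ⟨hg.2.2.2.2.1, hg.2.2.2.2.2⟩⟩
  · simp only [Lit.eval, Bool.false_eq_true, false_iff]
    exact fun hg => h ⟨hg.1, hg.2.1, hg.2.2.1, hg.2.2.2.1⟩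

/-- **The projection.** The edge `{u, w}` of `K_M` (vertices of the gadget enumerated by `eV`)
is replaced by the literal of the pair of gadget vertices (ordered by index, so that the
definition is symmetric). [folklore] -/
def rho (e : (⊤ : SimpleGraph (Fin (M n L))).edgeSet) : Lit (Pool n) :=
  Sym2.lift ⟨fun u w => litOf eqn ((eV n L).symm (min u w)) ((eV n L).symm (max u w)),
    fun u w => by
      dsimp only
      rw [min_comm u w, max_comm u w]⟩ (e : Sym2 (Fin (M n L)))

/-- Evaluation of the projection on an edge `{u, w}`. [folklore] -/
theorem rho_eval_iff (v : Pool n → Bool) {u w : Fin (M n L)}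
    (h : s(u, w) ∈ (⊤ : SimpleGraph (Fin (M n L))).edgeSet) :
    (rho eqn ⟨s(u, w), h⟩).eval v = true ↔ Good eqn v ((eV n L).symm u) ((eV n L).symm w) := by
  simp only [rho, Sym2.lift_mk]
  rcases le_total u w with hle | hle
  · rw [min_eq_left hle, max_eq_right hle, litOf_eval]
  · rw [min_eq_right hle, max_eq_left hle, litOf_eval, good_comm]

/-- Adjacency of the substituted graph: distinct indices of gadget-adjacent vertices. [folklore] -/
theorem adj_iff (v : Pool n → Bool) (u w : Fin (M n L)) :
    (cliqueGraph fun e => (rho eqn e).eval v).Adj u w ↔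
      u ≠ w ∧ Good eqn v ((eV n L).symm u) ((eV n L).symm w) := by
  rw [cliqueGraph_adj]
  constructor
  · rintro ⟨hne, h⟩
    exact ⟨hne, (rho_eval_iff eqn v _).1 h⟩
  · rintro ⟨hne, h⟩
    exact ⟨hne, (rho_eval_iff eqn v _).2 h⟩

/-- `CLIQUE(M, k)` of the substituted graph is on iff some `k` indices are pairwise
gadget-adjacent. [folklore] -/
theorem cliqueFn_rho_iff (v : Pool n → Bool) (k : ℕ) :
    cliqueFn (M n L) k (fun e => (rho eqn e).eval v) = true ↔
      ∃ S : Finset (Fin (M n L)), S.card = k ∧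
        ∀ u ∈ S, ∀ u' ∈ S, u ≠ u' → Good eqn v ((eV n L).symm u) ((eV n L).symm u') := by
  rw [cliqueFn_eq_true_iff]
  simp only [SimpleGraph.CliqueFree, not_forall, not_not, SimpleGraph.isNClique_iff,
    SimpleGraph.isClique_iff, Set.Pairwise, Finset.mem_coe]
  constructor
  · rintro ⟨S, hcl, hcard⟩
    exact ⟨S, hcard, fun u hu u' hu' hne => ((adj_iff eqn v u u').1 (hcl hu hu' hne)).2⟩
  · rintro ⟨S, hcard, hS⟩
    exact ⟨S, fun u hu u' hu' hne => (adj_iff eqn v u u').2 ⟨hne, hS u hu u' hu' hne⟩, hcard⟩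

/-! ## §2 The projection, the corner `n = 0`, sizes, and the stub -/

/-- The number of steps of the gadget: `#Pool n = 2n³`. [folklore] -/
def nSteps (n : ℕ) : ℕ := Fintype.card (Pool n)

/-- The steps enumerate the pool. [folklore] -/
def eqv (n : ℕ) : Fin (nSteps n) ≃ Pool n := (Fintype.equivFin (Pool n)).symm

/-- `#Pool n = 2n³`. [folklore] -/
theorem nSteps_eq (n : ℕ) : nSteps n = n * (n * (n * 2)) := by
  simp only [nSteps, Fintype.card_prod, Fintype.card_fin, ZMod.card]

/-- **The gadget projects `CLIQUE` onto `3XOR-UNSAT`** (`n + 1 ≥ 1` variables):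
`CLIQUE(M, 2(n+1)³(n+2))` with the literals `rho` is `3XOR-UNSAT_{n+1}`. [folklore] -/
theorem projectsOnto_succ (n : ℕ) :
    ProjectsOnto (M (n + 1) (nSteps (n + 1))) (nSteps (n + 1) * (n + 1 + 1)) (xor3Unsat (n + 1)) := by
  classical
  refine ⟨rho (eqv (n + 1)), fun v => ?_⟩
  rw [Bool.eq_iff_iff, cliqueFn_rho_iff, xorGadget_goodSet_iff (Nat.succ_pos n) (eqv (n + 1)) v]
  simp only [xor3Unsat, decide_eq_true_eq]
  exact Iff.rfl

/-- The degenerate case `n = 0` (no variables, `3XOR-UNSAT_0 ≡ 0`): `CLIQUE(0, 1) ≡ 0`. [folklore] -/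
theorem projectsOnto_zero : ProjectsOnto 0 1 (xor3Unsat 0) := by
  refine ⟨fun _ => Lit.const false, fun v => ?_⟩
  have h1 : cliqueFn 0 1 (fun e => (Lit.const false : Lit (Pool 0)).eval v) = false := by
    rw [cliqueFn_eq_false_iff]
    intro t ht
    obtain ⟨a, -⟩ := SimpleGraph.isNClique_one.1 ht
    exact a.elim0
  have h2 : xor3Unsat 0 v = false := by
    classical
    simp only [xor3Unsat, decide_eq_false_iff_not, not_not]
    exact ⟨fun i => i.elim0, fun e => e.1.elim0⟩
  rw [h1, h2]

/-- Size of the board: `M ≤ 8 (n+1)³ (n+2) ≤ (n+3)^8`. [folklore] -/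
theorem M_bound (n : ℕ) : M (n + 1) (nSteps (n + 1)) ≤ (n + 1 + 2) ^ 8 := by
  refine M_le.trans ?_
  rw [nSteps_eq]
  have h1 : n + 1 ≤ n + 3 := by omega
  have h2 : 2 ≤ n + 3 := by omega
  have h3 : n + 1 + 1 ≤ n + 3 := by omega
  calc (n + 1) * ((n + 1) * ((n + 1) * 2)) * ((n + 1 + 1) * (2 * 2))
      ≤ (n + 3) * ((n + 3) * ((n + 3) * (n + 3))) * ((n + 3) * ((n + 3) * (n + 3))) := by
        apply_rules [Nat.mul_le_mul]
    _ = (n + 3) ^ 7 := by ring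
    _ ≤ (n + 3) ^ 8 := Nat.pow_le_pow_right (by omega) (by omega)
    _ = (n + 1 + 2) ^ 8 := by ring

/-- Size of the clique: `k = 2 (n+1)³ (n+2) ≤ (n+3)^8`. [folklore] -/
theorem k_bound (n : ℕ) : nSteps (n + 1) * (n + 1 + 1) ≤ (n + 1 + 2) ^ 8 := by
  rw [nSteps_eq]
  have h1 : n + 1 ≤ n + 3 := by omega
  have h2 : 2 ≤ n + 3 := by omega
  have h3 : n + 1 + 1 ≤ n + 3 := by omega
  calc (n + 1) * ((n + 1) * ((n + 1) * 2)) * (n + 1 + 1)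
      ≤ (n + 3) * ((n + 3) * ((n + 3) * (n + 3))) * (n + 3) := by
        apply_rules [Nat.mul_le_mul]
    _ = (n + 3) ^ 5 := by ring
    _ ≤ (n + 3) ^ 8 := Nat.pow_le_pow_right (by omega) (by omega)
    _ = (n + 1 + 2) ^ 8 := by ring

end CliqueXor

open CliqueXor in
/-- **(T1) `3XOR-UNSAT` is a polynomial monotone AND-projection of `CLIQUE`**: for every `n`,
`3XOR-UNSAT_n` on the 3-sparse pool is `CLIQUE(M, k)` with literals (constants, variables, ANDs of
two variables) substituted for the edges, `M, k ≤ (n + 2)^8`. For `n ≥ 1` this is the derivation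
gadget (`projectsOnto_succ`); for `n = 0` the constant `0 = CLIQUE(0, 1)`. [folklore] -/
theorem stub_cliqueProjectsXor : XorIsCliqueProjection := by
  refine ⟨8, fun n => ?_⟩
  cases n with
  | zero => exact ⟨0, 1, Nat.zero_le _, Nat.one_le_pow _ _ (by norm_num), projectsOnto_zero⟩
  | succ n => exact ⟨_, _, M_bound n, k_bound n, projectsOnto_succ n⟩

end

end Summit.PneNP.PneNP.Theorems.XorDoor
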